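import Summits.BirchSwinnertonDyer.BirchSwinnertonDyer.Theorems.PrintCFramAcDescentThreeSplitOrbit
import Literature.NumberTheory.EllipticCurves.ShaIsogenyProofs
import Literature.NumberTheory.EllipticCurves.IsogenyGeomEndRingProofs
import HarnessLib

/-!
# «H-orbit»: the `End_K(E_K)`-translates of a norm-compatible relaxed-Selmer family ARE
# norm-compatible relaxed-Selmer families — so the orbit `endOrbit 𝒮 z` contains an element over
# EVERY `φ ∈ End_K(E_K)`, with no side hypotheses (cell `bsd-print-cfram`, D-0131 (2) PRINT tier,
# prover seat p2 gen 3; referee A96 remark (i) «recommended next helper H-orbit»; line «acdescent3»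
# on item stmt-BirchSwinnertonDyer-21353, `--supports … --as helper`)

p570848 typed the `Λ`-adic carrier `endOrbitSpan 𝒮 z` (the `Λ`-span of the elements of the relaxed
`Λ`-adic Selmer datum `𝒮` projecting to an `End_K(E_K)`-translate of the family `z`) in HONEST-∃
shape: its lemma `exists_mem_endOrbit_of_translate` produced the element over `φ` only under the
hypotheses `hmem` (every `φ · z_n` is a relaxed compact Selmer family) and `hnorm` (the translates
are norm-compatible). THIS FILE DISCHARGES BOTH for every `φ ∈ End_K(E_K)` (`WeierstrassCurve.endRing`,
the tree's `K`-rational geometric endomorphisms), for every elliptic curve over a number field,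
every prime `p`, every normal subgroup / `ℤ_p`-tower and every relaxed set `P`:

* §1 FUNCTORIALITY (pure `resH1Hom_comp`): `endH1 φ` commutes with `conj_σ` (`φ` is
  `Γ_K`-equivariant), with `res` along `H ≤ H'`, and with the transition maps `p_*`; hence `endPi φ`
  commutes with `conjPi`, `resPi` and preserves `compatiblePi`.
* §2 LOCAL POINTS MAPS for `φ ∈ End_K(E_K)`: by the tree's `mem_geomEndRing_iff_holds` a `K`-rational
  endomorphism is `0` or ALGEBRAIC, hence (with its equivariance and `IsAlgebraicOn.finite_ker`) an
  `Isogeny E → E`, and isogenies act on the points over every extension field compatibly with the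
  chosen embeddings (`Isogeny.hasLocalPointsMaps_toAddMonoidHom`, file `ShaIsogenyProofs`):
  `hasLocalPointsMaps_of_mem_endRing`.
* §3 LOCAL KERNELS: `endH1 φ` maps the kernel of each local restriction
  `H¹(H, E[m]) → H¹(H_v, E(K̄_v))` into itself (the square of compatible pairs commutes —
  `resH1Hom_comp`, exactly as the tree's `galH1Map_mem_localRestrictionKer` for `Ш`).
* §4 SELMER: `endH1 φ` preserves `relaxedSelmerTorsionOver H m P` and `endPi φ` preserves
  `relaxedCompactSelmerOver H p P` (`endPi_mem_relaxedCompactSelmerOver`).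
* §5 THE ORBIT IS FULL: for every relaxed `Λ`-adic datum `𝒮`, every norm-compatible relaxed family
  `z` (in particular `D.z` of an `EllipticUnitClassData`) and EVERY `φ ∈ End_K(E_K)` there is
  `s ∈ endOrbit 𝒮 z` with `proj n s = φ · z_n` for all `n` (`exists_mem_endOrbit_proj_eq_endPi`,
  `exists_mem_endOrbit_proj_eq_endPi_of_datum`). So `endOrbitSpan 𝒮 D.z` is, BY NAME, the `Λ`-span of
  ALL `End_K(E_K)`-translates of `z^ac` — [BKNO]'s `Λ_𝒪 · z^ac` (`𝒪 = End_K(E_K) ⊗ ℤ_p`) — and the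
  honest-∃ caveat (i) of referee audit A96 is gone.

No statement about any curve's arithmetic is asserted; pure functoriality over the tree's objects.
«beyond-print theorem»: NO.

References: J.-P. Serre, *Galois Cohomology*, I.§2.4–2.5 (functoriality of `H¹` in compatible pairs,
conjugation) [SerreGaloisCohomology1997]; J. H. Silverman, *AEC* III.§4 (End_K(E); isogenies are
algebraic homomorphisms) [SilvermanAEC2009]; B. Perrin-Riou, Bull. SMF 115 (1987) §0 (compact Selmer
groups as `ℤ_p`- and `𝒪`-modules) [PerrinRiou1987BSMF]; [BurungaleKobayashiNakamuraOta2026] §3.2.1–3.3.1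
(arXiv:2608.06879v1 pp. 17–19: `T`, `𝒮^ac_rel`, `Λ_ac z^ac` as `𝒪`-modules); tree `SubgroupSelmer`
(`resH1Hom_comp`), `ShaIsogeny{,Proofs}` (`HasLocalPointsMaps`), `IsogenyGeomEndRingProofs`
(`mem_geomEndRing_iff_holds`), `BurungaleKobayashiNakamuraOta2026/AnticyclotomicEllipticUnitClass`
(`endH1`, `endPi`, `relaxedCompactSelmerOver`), p570848.
-/

-- the summit namespace `Summit.BirchSwinnertonDyer.BirchSwinnertonDyer` repeats the problem name by design (D-0017)
set_option linter.dupNamespace false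

noncomputable section

open scoped Classical

open WeierstrassCurve NumberField IsDedekindDomain Field
  Literature.NumberTheory.GaloisRepresentations
  Literature.NumberTheory.EllipticCurves
  Literature.NumberTheory.EllipticCurves.BurungaleKobayashiNakamuraOta2026
  Summit.BirchSwinnertonDyer.BirchSwinnertonDyer.Theorems.PrintCFram.AcDescentThreeSplit

namespace Summit.BirchSwinnertonDyer.BirchSwinnertonDyer.Theorems.PrintCFram.AcDescentThreeOrbit

/-! ## §1 Functoriality: `endH1 φ` commutes with conjugation, restriction and the transition maps -/

section Functoriality

variable {K : Type} [Field K] (V : WeierstrassCurve K) {φ : AddMonoid.End V.geomPoints}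
  (hφ : φ ∈ V.endRing)

/-- **`endH1 φ ∘ conj_σ = conj_σ ∘ endH1 φ`** on `H¹(H, E[m])` (`φ` commutes with `Γ_K`; both maps
are maps of compatible pairs, `resH1Hom_comp`). [cite: SerreGaloisCohomology1997, I.§2.4–2.5 (functoriality of H¹ in compatible pairs; conjugation)] -/
theorem endH1_conjH1 (m : ℤ) (H : Subgroup (absoluteGaloisGroup K)) [H.Normal]
    (σ : absoluteGaloisGroup K) (x : V.torsionH1Over m H) :
    V.endH1 hφ m H (Literature.NumberTheory.EllipticCurves.conjH1 H (geomTorsion V m) σ x) =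
      Literature.NumberTheory.EllipticCurves.conjH1 H (geomTorsion V m) σ (V.endH1 hφ m H x) := by
  change ((V.endH1 hφ m H).comp
      (Literature.NumberTheory.EllipticCurves.conjH1 H (geomTorsion V m) σ)) x =
    ((Literature.NumberTheory.EllipticCurves.conjH1 H (geomTorsion V m) σ).comp (V.endH1 hφ m H)) x
  congr 1
  rw [endH1, Literature.NumberTheory.EllipticCurves.conjH1, resH1Hom_comp, resH1Hom_comp]
  refine resH1Hom_congr (by ext; rfl) ?_ _ _
  ext P
  change φ (σ • (P : V.geomPoints)) = σ • φ (P : V.geomPoints)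
  exact hφ.2 σ P

/-- **`endH1 φ ∘ res = res ∘ endH1 φ`** for subgroups `H ≤ H'` (`resH1Hom_comp`).
[cite: SerreGaloisCohomology1997, I.§2.4–2.5 (functoriality of H¹; restriction)] -/
theorem endH1_resOfLe (m : ℤ) {H H' : Subgroup (absoluteGaloisGroup K)} (h : H ≤ H')
    (x : V.torsionH1Over m H') :
    V.endH1 hφ m H (Literature.NumberTheory.EllipticCurves.resOfLe (geomTorsion V m) h x) =
      Literature.NumberTheory.EllipticCurves.resOfLe (geomTorsion V m) h (V.endH1 hφ m H' x) := by
  change ((V.endH1 hφ m H).comp (Literature.NumberTheory.EllipticCurves.resOfLe (geomTorsion V m) h)) x =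
    ((Literature.NumberTheory.EllipticCurves.resOfLe (geomTorsion V m) h).comp (V.endH1 hφ m H')) x
  congr 1
  rw [endH1, endH1, Literature.NumberTheory.EllipticCurves.resOfLe, resH1Hom_comp, resH1Hom_comp]
  exact resH1Hom_congr (by ext; rfl) (by ext; rfl) _ _

/-- **`p_* ∘ endH1 φ = endH1 φ ∘ p_*`** for the transition maps `H¹(H, E[p^{k+1}]) → H¹(H, E[p^k])`
(`φ` is additive, so it commutes with `p •`). [cite: PerrinRiou1987BSMF, §0 p. 401 (the transition maps of S_p(L))] -/
theorem reduceTorsionH1_endH1 (p k : ℕ) (H : Subgroup (absoluteGaloisGroup K))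
    (x : V.torsionH1Over ((p : ℤ) ^ (k + 1)) H) :
    V.reduceTorsionH1 p k H (V.endH1 hφ ((p : ℤ) ^ (k + 1)) H x) =
      V.endH1 hφ ((p : ℤ) ^ k) H (V.reduceTorsionH1 p k H x) := by
  change ((V.reduceTorsionH1 p k H).comp (V.endH1 hφ ((p : ℤ) ^ (k + 1)) H)) x =
    ((V.endH1 hφ ((p : ℤ) ^ k) H).comp (V.reduceTorsionH1 p k H)) x
  congr 1
  rw [endH1, endH1, reduceTorsionH1, resH1Hom_comp, resH1Hom_comp]
  refine resH1Hom_congr (by ext; rfl) ?_ _ _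
  ext P
  change (p : ℤ) • φ (P : V.geomPoints) = φ ((p : ℤ) • (P : V.geomPoints))
  rw [map_zsmul]

/-- **`endPi φ ∘ conjPi σ = conjPi σ ∘ endPi φ`** on `∏_k H¹(H, E[p^k])` (componentwise `endH1_conjH1`).
[cite: SerreGaloisCohomology1997, I.§2.5 (conjugation on H¹)] -/
theorem endPi_conjPi (p : ℕ) (H : Subgroup (absoluteGaloisGroup K)) [H.Normal]
    (σ : absoluteGaloisGroup K) (x : Π k : ℕ, V.torsionH1Over ((p : ℤ) ^ k) H) :
    V.endPi hφ p H (V.conjPi p H σ x) = V.conjPi p H σ (V.endPi hφ p H x) := by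
  funext k
  exact endH1_conjH1 V hφ ((p : ℤ) ^ k) H σ (x k)

/-- **`endPi φ ∘ resPi = resPi ∘ endPi φ`** (componentwise `endH1_resOfLe`).
[cite: SerreGaloisCohomology1997, I.§2.5 (restriction on H¹)] -/
theorem endPi_resPi (p : ℕ) {H H' : Subgroup (absoluteGaloisGroup K)} (h : H ≤ H')
    (x : Π k : ℕ, V.torsionH1Over ((p : ℤ) ^ k) H') :
    V.endPi hφ p H (V.resPi p h x) = V.resPi p h (V.endPi hφ p H' x) := by
  funext k
  exact endH1_resOfLe V hφ ((p : ℤ) ^ k) h (x k)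

/-- **`endPi φ` preserves the `p`-compatible families** (componentwise `reduceTorsionH1_endH1`).
[cite: PerrinRiou1987BSMF, §0 p. 401] -/
theorem endPi_mem_compatiblePi (p : ℕ) (H : Subgroup (absoluteGaloisGroup K))
    {x : Π k : ℕ, V.torsionH1Over ((p : ℤ) ^ k) H} (hx : x ∈ V.compatiblePi H p) :
    V.endPi hφ p H x ∈ V.compatiblePi H p := by
  rw [mem_compatiblePi_iff] at hx ⊢
  intro k
  change V.reduceTorsionH1 p k H (V.endH1 hφ ((p : ℤ) ^ (k + 1)) H (x (k + 1))) =
    V.endH1 hφ ((p : ℤ) ^ k) H (x k)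
  rw [reduceTorsionH1_endH1, hx k]

end Functoriality

/-! ## §2 Local points maps for `K`-rational endomorphisms -/

section LocalPoints

variable {K : Type} [Field K] (V : WeierstrassCurve K) [V.IsElliptic]

/-- **A `K`-rational endomorphism acts on the points over every extension field**, compatibly with
the chosen embeddings and `Γ_E`-equivariantly (`HasLocalPointsMaps V V φ`): `φ ∈ End_K(E)` is `0` (the
zero maps do) or algebraic (`mem_geomEndRing_iff_holds`), then an `Isogeny E → E` (equivariant,
`IsAlgebraicOn.finite_ker`) and isogenies have local points maps (`hasLocalPointsMaps_toAddMonoidHom`).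
[cite: SilvermanAEC2009, III.§4 (End_K(E) = {0} ∪ isogenies E → E defined over K)] -/
theorem hasLocalPointsMaps_of_mem_endRing {φ : AddMonoid.End V.geomPoints} (hφ : φ ∈ V.endRing) :
    HasLocalPointsMaps V V (φ : V.geomPoints →+ V.geomPoints) := by
  rcases (mem_geomEndRing_iff_holds V φ).mp hφ.1 with rfl | halg
  · intro E _ _
    refine ⟨0, fun _ _ ↦ by simp, fun P ↦ ?_⟩
    change (0 : localPoints V E) = pointsMap V E ((0 : V.geomPoints →+ V.geomPoints) P)
    rw [AddMonoidHom.zero_apply, map_zero]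
  · exact Isogeny.hasLocalPointsMaps_toAddMonoidHom
      { toAddMonoidHom := φ, isAlgebraic := halg, equivariant := hφ.2, finite_ker := halg.finite_ker }

end LocalPoints

/-! ## §3 `endH1 φ` respects the local kernels -/

section LocalKernel

variable {K : Type} [Field K] (V : WeierstrassCurve K) {φ : AddMonoid.End V.geomPoints}
  (hφ : φ ∈ V.endRing) (E : Type) [Field E] [Algebra K E]

/-- **`endH1 φ` maps `ker(H¹(H, E[m]) → H¹(H_E, E(K̄_E)))` into itself** when `φ` has a local points
map at `E` compatible with the chosen embedding: the square of compatible pairs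
`(H_E → H, E[m] ↪ E(K̄) → E(K̄_E))`, `(id, φ|_{E[m]})`, `(id, φ_E)` commutes (`resH1Hom_comp`), so
`res_E ∘ endH1 φ = H¹(φ_E) ∘ res_E`. [cite: SerreGaloisCohomology1997, I.§2.4 (functoriality of H¹ in compatible pairs)] -/
theorem localResTorsionOverOfEmb_endH1_eq_zero (m : ℤ) (H : Subgroup (absoluteGaloisGroup K))
    (fE : localPoints V E →+ localPoints V E)
    (hfE : ∀ (τ : absoluteGaloisGroup E) (P : localPoints V E), fE (τ • P) = τ • fE P)
    (hcomp : ∀ P : V.geomPoints, fE (pointsMap V E P) = pointsMap V E (φ P))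
    {x : V.torsionH1Over m H}
    (hx : V.localResTorsionOverOfEmb m H (closureEmb (K := K) E) x = 0) :
    V.localResTorsionOverOfEmb m H (closureEmb (K := K) E) (V.endH1 hφ m H x) = 0 := by
  have key : (V.localResTorsionOverOfEmb m H (closureEmb (K := K) E)).comp (V.endH1 hφ m H) =
      (resH1Hom (ContinuousMonoidHom.id (localSubgroupOfEmb H (closureEmb (K := K) E))) fE
          (fun τ P ↦ hfE τ P)).comp
        (V.localResTorsionOverOfEmb m H (closureEmb (K := K) E)) := by
    rw [localResTorsionOverOfEmb, endH1, resH1Hom_comp, resH1Hom_comp]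
    refine resH1Hom_congr (by ext; rfl) ?_ _ _
    ext P
    exact (hcomp (P : V.geomPoints)).symm
  have hkey := congrArg (fun F ↦ F x) key
  simp only [AddMonoidHom.comp_apply] at hkey
  rw [hkey, hx, map_zero]

end LocalKernel

/-! ## §4 `End_K(E_K)` preserves the relaxed (compact) Selmer groups -/

section Selmer

variable {K : Type} [Field K] [NumberField K] (V : WeierstrassCurve K) [V.IsElliptic]
  {φ : AddMonoid.End V.geomPoints} (hφ : φ ∈ V.endRing)
  (H : Subgroup (absoluteGaloisGroup K)) [H.Normal]

/-- **`End_K(E)` preserves the relaxed `m`-Selmer group**: `φ · Sel^{(m)}_{rel,P}(E/L) ⊆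
Sel^{(m)}_{rel,P}(E/L)` — the local conditions off `P` and at infinity are local restriction kernels
at all `Γ_K`-conjugates; `endH1 φ` commutes with `conj_σ` (§1) and respects each local kernel (§3, with
the local points maps of §2). [cite: PerrinRiou1987BSMF, §0 p. 401 (S_p(L) as an End-module)]
[cite: BurungaleKobayashiNakamuraOta2026, §3.2.1 and §3.3.1 (arXiv:2608.06879v1 pp. 17, 19) (Selmer groups as 𝒪-modules; shape only)] -/
theorem endH1_mem_relaxedSelmerTorsionOver (m : ℤ) (P : Set (HeightOneSpectrum (𝓞 K)))
    {x : V.torsionH1Over m H} (hx : x ∈ V.relaxedSelmerTorsionOver H m P) :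
    V.endH1 hφ m H x ∈ V.relaxedSelmerTorsionOver H m P := by
  rw [mem_relaxedSelmerTorsionOver_iff] at hx ⊢
  refine ⟨fun v hv σ ↦ ?_, fun w σ ↦ ?_⟩
  · obtain ⟨fE, hfE, hcomp⟩ := hasLocalPointsMaps_of_mem_endRing V hφ (v.adicCompletion K)
    rw [← endH1_conjH1]
    exact localResTorsionOverOfEmb_endH1_eq_zero V hφ _ m H fE hfE hcomp (hx.1 v hv σ)
  · obtain ⟨fE, hfE, hcomp⟩ := hasLocalPointsMaps_of_mem_endRing V hφ w.Completion
    rw [← endH1_conjH1]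
    exact localResTorsionOverOfEmb_endH1_eq_zero V hφ _ m H fE hfE hcomp (hx.2 w σ)

/-- **`End_K(E)` preserves the relaxed compact Selmer group** `S_{p,rel}(E/L)` (levelwise
`endH1_mem_relaxedSelmerTorsionOver` + `endPi_mem_compatiblePi`): `endPi_mem_relaxedCompactSelmerOver`.
[cite: PerrinRiou1987BSMF, §0 p. 401] [cite: BurungaleKobayashiNakamuraOta2026, §3.3.1 (arXiv:2608.06879v1 p. 19) (shape only)] -/
theorem endPi_mem_relaxedCompactSelmerOver (p : ℕ) (P : Set (HeightOneSpectrum (𝓞 K)))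
    {x : Π k : ℕ, V.torsionH1Over ((p : ℤ) ^ k) H} (hx : x ∈ V.relaxedCompactSelmerOver H p P) :
    V.endPi hφ p H x ∈ V.relaxedCompactSelmerOver H p P := by
  rw [mem_relaxedCompactSelmerOver_iff] at hx ⊢
  exact ⟨fun k ↦ endH1_mem_relaxedSelmerTorsionOver V hφ H ((p : ℤ) ^ k) P (hx.1 k),
    endPi_mem_compatiblePi V hφ p H hx.2⟩

end Selmer

/-! ## §5 The orbit is full: an element over every `φ ∈ End_K(E_K)` -/

section Orbit

variable {K : Type} [Field K] [NumberField K] {p : ℕ} [Fact p.Prime]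
  {V : WeierstrassCurve K} [V.IsElliptic] {κ : ZpExtension K p} {γ : absoluteGaloisGroup K}
  {𝔭 : HeightOneSpectrum (𝓞 K)}

omit [NumberField K] [V.IsElliptic] in
/-- **Translates of a norm-compatible family are norm-compatible**: if
`res(z_n) = Σ_{i<p} conj_{γ^{pⁿ i}}(z_{n+1})` for all `n`, the same holds for `(φ · z_n)_n`
(`endPi_resPi`, `endPi_conjPi`, additivity). [cite: PerrinRiou1987BSMF, §0 pp. 401–402 (norm-compatible families)] -/
theorem endPi_norm {φ : AddMonoid.End V.geomPoints} (hφ : φ ∈ V.endRing)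
    {z : Π n k : ℕ, V.torsionH1Over ((p : ℤ) ^ k) (κ.layerSubgroup n)}
    (hz : ∀ n, V.resPi p (κ.layerSubgroup_antitone (Nat.le_succ n)) (z n) =
      ∑ i ∈ Finset.range p, V.conjPi p (κ.layerSubgroup (n + 1)) (γ ^ (p ^ n * i)) (z (n + 1)))
    (n : ℕ) :
    V.resPi p (κ.layerSubgroup_antitone (Nat.le_succ n)) (V.endPi hφ p (κ.layerSubgroup n) (z n)) =
      ∑ i ∈ Finset.range p, V.conjPi p (κ.layerSubgroup (n + 1)) (γ ^ (p ^ n * i))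
        (V.endPi hφ p (κ.layerSubgroup (n + 1)) (z (n + 1))) := by
  rw [← endPi_resPi, hz n, map_sum]
  exact Finset.sum_congr rfl fun i _ ↦ endPi_conjPi V hφ p _ _ _

/-- **The orbit is full.** For every relaxed `Λ`-adic datum `𝒮`, every norm-compatible family `z` of
relaxed compact Selmer elements and EVERY `φ ∈ End_K(E_K)` there is `s ∈ endOrbit 𝒮 z` projecting to
the translate family `(φ · z_n)_n` — p570848's `exists_mem_endOrbit_of_translate` with its two
hypotheses DISCHARGED (`endPi_mem_relaxedCompactSelmerOver`, `endPi_norm`). Hence `endOrbitSpan 𝒮 z`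
is the `Λ`-span of ALL `End_K(E_K)`-translates: [BKNO]'s `Λ_𝒪 · z`.
[cite: BurungaleKobayashiNakamuraOta2026, §3.3.1 and Prop. 3.7 (4) (arXiv:2608.06879v1 pp. 19–20) (the module Λ_ac z^ac; shape only)] -/
theorem exists_mem_endOrbit_proj_eq_endPi (𝒮 : LambdaAdicRelaxedSelmerData V κ γ 𝔭)
    {z : Π n k : ℕ, V.torsionH1Over ((p : ℤ) ^ k) (κ.layerSubgroup n)}
    (hmem : ∀ n, z n ∈ V.relaxedCompactSelmerOver (κ.layerSubgroup n) p {𝔭})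
    (hnorm : ∀ n, V.resPi p (κ.layerSubgroup_antitone (Nat.le_succ n)) (z n) =
      ∑ i ∈ Finset.range p, V.conjPi p (κ.layerSubgroup (n + 1)) (γ ^ (p ^ n * i)) (z (n + 1)))
    {φ : AddMonoid.End V.geomPoints} (hφ : φ ∈ V.endRing) :
    ∃ s ∈ endOrbit 𝒮 z, ∀ n, 𝒮.proj n s = V.endPi hφ p (κ.layerSubgroup n) (z n) :=
  exists_mem_endOrbit_of_translate 𝒮 hφ
    (fun n ↦ endPi_mem_relaxedCompactSelmerOver V hφ _ p {𝔭} (hmem n)) (endPi_norm hφ hnorm)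

/-- **The orbit of the anticyclotomic class of an elliptic-unit datum is full**: for `D :
EllipticUnitClassData W p K 𝔭 κ γ ι φ Ω 𝓔` and EVERY `ψ ∈ End_K(E_K)` some `s ∈ endOrbit 𝒮 D.z` projects
to `(ψ · z_n)_n` (`D.z_mem`, `D.z_norm`). For a CM curve over its CM field and `ψ = [ω]` this is the
second `Λ`-generator of `Λ_𝒪 · z^ac = endOrbitSpan 𝒮 D.z`.
[cite: BurungaleKobayashiNakamuraOta2026, (3.9) and Prop. 3.7 (4) (arXiv:2608.06879v1 pp. 19–20) (claim; preprint; shape only)] -/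
theorem exists_mem_endOrbit_proj_eq_endPi_of_datum {W : WeierstrassCurve ℚ} [W.IsElliptic]
    [(W.baseChange K).IsElliptic] {ι : PadicAlgCl p ≃+* ℂ} {φ : HeckeCharacter K} {Ω : ℂ}
    {𝓔 : AcDualExpSystem W p K 𝔭 κ ι}
    (𝒮 : LambdaAdicRelaxedSelmerData (W.baseChange K) κ γ 𝔭)
    (D : EllipticUnitClassData W p K 𝔭 κ γ ι φ Ω 𝓔)
    {ψ : AddMonoid.End (W.baseChange K).geomPoints} (hψ : ψ ∈ (W.baseChange K).endRing) :
    ∃ s ∈ endOrbit 𝒮 D.z, ∀ n, 𝒮.proj n s = (W.baseChange K).endPi hψ p (κ.layerSubgroup n) (D.z n) :=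
  exists_mem_endOrbit_proj_eq_endPi 𝒮 D.z_mem D.z_norm hψ

end Orbit

end Summit.BirchSwinnertonDyer.BirchSwinnertonDyer.Theorems.PrintCFram.AcDescentThreeOrbit

end
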